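import Summits.ABC.IUTFork.Cor312LicenceTripleUnconditionalSlot
import Summits.ABC.IUTFork.Conditional.WRowUnconditionalCellsSlot
import HarnessLib

/-!
# R-W WINDOW-TABLE «W:HEX-INHABITED-BANDS» — the abc triples `(7^k + 4) + (7^k − 4) = 2·7^k` behind the HEX family `λ_k = 1/2 + 2/7^k`, `k ∈ {4, 6, 8}`:
# triple, prime divisors, valuations (shared arithmetic prelude of the `k = 4, 6, 8` band files)

PROOF-ONLY file (D-0012; 0 definitions, 0 `Prop` facts; elementary arithmetic only) of the abc-iut cell — D-0079 RESCUE sub-cell R-W «WINDOW Θ-SIDE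
INEQUALITY», prover seat abc-iut-w5-d107 (gen 9), claim «W:HEX-INHABITED-BANDS» (lane P+). For each `k ∈ {4, 6, 8}`: `isABCTriple_hex<k>` (the triple
`(7^k + 4) + (7^k − 4) = 2·7^k`, coprime since both summands are odd and differ by `8`), `lamSeven_eq_hex<k>` (`1/2 + 2/7^k = (7^k + 4)/(2·7^k)`: the HEX
parameter of abc-iut-w5-d044's family `Cor22.exists_admissible_prime_ratPoint_lamSeven` IS the Frey–Legendre point `a/c` of that triple),
`eq_of_prime_dvd_triple_hex<k>` (the prime divisors of `abc`) and `factorization_triple_hex<k>` (the valuations `v_p(abc)` at the odd ones); for `k = 6`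
also `WRow.not_dvd_31_sub_one_hex6` (a prime level `l ≥ 11` does not divide `30`) and the exact `p = 7` cells `WRow.hexcell_six_small` (`l = 11, 13, 17`) /
`WRow.hexcell_eight_small` (`l = 73`) below the symbolic thresholds `19` / `79`. Consumers: `WRowHexLamSeven{Four,Six,Eight}AllLevels.lean`,
`WRowHexLamSevenSixSmallLevels.lean`, `WRowHexLamSevenEightSeventyThree.lean` (the band files for `k = 1, 2, 3, 5, 7` carry their own three-prime preludes).
HONEST SCOPE: integer arithmetic only; nothing here bears on the printed inequality or any author; no abc claim. [folklore]
-/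

noncomputable section

open Set Function Metric NumberField IsDedekindDomain

namespace Summit.ABC.IUTFork.Conditional

open Thm311 Thm311.Real Cor312 Cor312Vol Cor312Prov Literature.IUT.LogThetaLattice Literature.IUT.LogVolume
  Literature.IUT.HodgeTheaters Literature.IUT.LogVolume.Cor22
open Literature.NumberTheory.NumberFields Literature.NumberTheory.GaloisRepresentations.Ultrametric
open Literature.NumberTheory.DiophantineGeometry Literature.NumberTheory.DiophantineGeometry.GenEll

/-- `v_p(n) = k` from `n = p^k·m` with `p ∤ m`. [folklore] -/
private theorem factorization_eq_of_eq_pow_mul_aux {p k m n : ℕ} (hp : p.Prime) (hn : n = p ^ k * m) (hm : ¬ p ∣ m) :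
    n.factorization p = k := by
  subst hn
  have hm0 : m ≠ 0 := fun h => hm (h ▸ dvd_zero p)
  rw [Nat.factorization_mul (pow_ne_zero _ hp.ne_zero) hm0, Finsupp.add_apply, hp.factorization_pow, Finsupp.single_eq_same,
    Nat.factorization_eq_zero_of_not_dvd hm, add_zero]

/-! ## `k = 4`: `2405 + 2397 = 4802` -/

/-- `(7⁴ + 4) + (7⁴ − 4) = 2·7⁴`, i.e. `2405 + 2397 = 4802` (`2405 = 5·13·37`, `2397 = 3·17·47`): the abc triple whose Frey–Legendre
point `a/c = 2405/4802` is the HEX parameter `λ_4 = 1/2 + 2/7⁴` of the R-W table (abc-iut-w5-d044 `Cor22.exists_admissible_prime_ratPoint_lamSeven`). [folklore] -/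
theorem isABCTriple_hex4 : IsABCTriple 2405 2397 4802 :=
  ⟨by norm_num, by norm_num, by norm_num, by norm_num [Nat.coprime_iff_gcd_eq_one]⟩

/-- `λ_4 = 1/2 + 2/7⁴ = 2405/4802`. [folklore] -/
theorem lamSeven_eq_hex4 : (2 : ℚ)⁻¹ + 2 / 7 ^ 4 = ((2405 : ℕ) : ℚ) / (4802 : ℕ) := by norm_num

/-- The prime divisors of `2405 · 2397 · 4802 = 2 · 3 · 5 · 7⁴ · 13 · 17 · 37 · 47`. [folklore] -/
theorem eq_of_prime_dvd_triple_hex4 {p : ℕ} (hp : p.Prime) (h : p ∣ 2405 * 2397 * 4802) :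
    p = 2 ∨ p = 3 ∨ p = 5 ∨ p = 7 ∨ p = 13 ∨ p = 17 ∨ p = 37 ∨ p = 47 := by
  have h' : p ∣ 2 * (3 * (5 * (7 ^ 4 * (13 * (17 * (37 * (47))))))) := by norm_num at h ⊢; exact h
  have key : ∀ {q k : ℕ}, q.Prime → p ∣ q ^ k → p = q := fun hq hd => (Nat.prime_dvd_prime_iff_eq hp hq).1 (hp.dvd_of_dvd_pow hd)
  rcases (Nat.Prime.dvd_mul hp).1 h' with h1 | h1
  · exact (Or.inl ((Nat.prime_dvd_prime_iff_eq hp Nat.prime_two).1 h1))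
  · rcases (Nat.Prime.dvd_mul hp).1 h1 with h2 | h2
    · exact (Or.inr (Or.inl ((Nat.prime_dvd_prime_iff_eq hp Nat.prime_three).1 h2)))
    · rcases (Nat.Prime.dvd_mul hp).1 h2 with h3 | h3
      · exact (Or.inr (Or.inr (Or.inl ((Nat.prime_dvd_prime_iff_eq hp Nat.prime_five).1 h3))))
      · rcases (Nat.Prime.dvd_mul hp).1 h3 with h4 | h4
        · exact (Or.inr (Or.inr (Or.inr (Or.inl (key (by norm_num : Nat.Prime 7) h4)))))
        · rcases (Nat.Prime.dvd_mul hp).1 h4 with h5 | h5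
          · exact (Or.inr (Or.inr (Or.inr (Or.inr (Or.inl ((Nat.prime_dvd_prime_iff_eq hp (by norm_num : Nat.Prime 13)).1 h5))))))
          · rcases (Nat.Prime.dvd_mul hp).1 h5 with h6 | h6
            · exact (Or.inr (Or.inr (Or.inr (Or.inr (Or.inr (Or.inl ((Nat.prime_dvd_prime_iff_eq hp (by norm_num : Nat.Prime 17)).1 h6)))))))
            · rcases (Nat.Prime.dvd_mul hp).1 h6 with h7 | h7
              · exact (Or.inr (Or.inr (Or.inr (Or.inr (Or.inr (Or.inr (Or.inl ((Nat.prime_dvd_prime_iff_eq hp (by norm_num : Nat.Prime 37)).1 h7))))))))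
              · exact (Or.inr (Or.inr (Or.inr (Or.inr (Or.inr (Or.inr (Or.inr ((Nat.prime_dvd_prime_iff_eq hp (by norm_num : Nat.Prime 47)).1 h7))))))))

/-- `v_3 = 1`, `v_5 = 1`, `v_7 = 4`, `v_13 = 1`, `v_17 = 1`, `v_37 = 1`, `v_47 = 1` for `abc = 2405 · 2397 · 4802`. [folklore] -/
theorem factorization_triple_hex4 :
    (2405 * 2397 * 4802).factorization 3 = 1 ∧
      (2405 * 2397 * 4802).factorization 5 = 1 ∧
      (2405 * 2397 * 4802).factorization 7 = 4 ∧
      (2405 * 2397 * 4802).factorization 13 = 1 ∧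
      (2405 * 2397 * 4802).factorization 17 = 1 ∧
      (2405 * 2397 * 4802).factorization 37 = 1 ∧
      (2405 * 2397 * 4802).factorization 47 = 1 :=
  ⟨factorization_eq_of_eq_pow_mul_aux (m := 9227499190) Nat.prime_three (by norm_num) (by norm_num),
    factorization_eq_of_eq_pow_mul_aux (m := 5536499514) Nat.prime_five (by norm_num) (by norm_num),
    factorization_eq_of_eq_pow_mul_aux (m := 11529570) (by norm_num : Nat.Prime 7) (by norm_num) (by norm_num),
    factorization_eq_of_eq_pow_mul_aux (m := 2129422890) (by norm_num : Nat.Prime 13) (by norm_num) (by norm_num),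
    factorization_eq_of_eq_pow_mul_aux (m := 1628382210) (by norm_num : Nat.Prime 17) (by norm_num) (by norm_num),
    factorization_eq_of_eq_pow_mul_aux (m := 748175610) (by norm_num : Nat.Prime 37) (by norm_num) (by norm_num),
    factorization_eq_of_eq_pow_mul_aux (m := 588989310) (by norm_num : Nat.Prime 47) (by norm_num) (by norm_num)⟩

/-! ## `k = 6`: `117653 + 117645 = 235298` -/

/-- `(7⁶ + 4) + (7⁶ − 4) = 2·7⁶`, i.e. `117653 + 117645 = 235298` (`117653 = 29·4057`, `117645 = 3·5·11·23·31`): the abc triple whose Frey–Legendre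
point `a/c = 117653/235298` is the HEX parameter `λ_6 = 1/2 + 2/7⁶` of the R-W table (abc-iut-w5-d044 `Cor22.exists_admissible_prime_ratPoint_lamSeven`). [folklore] -/
theorem isABCTriple_hex6 : IsABCTriple 117653 117645 235298 :=
  ⟨by norm_num, by norm_num, by norm_num, by norm_num [Nat.coprime_iff_gcd_eq_one]⟩

/-- `λ_6 = 1/2 + 2/7⁶ = 117653/235298`. [folklore] -/
theorem lamSeven_eq_hex6 : (2 : ℚ)⁻¹ + 2 / 7 ^ 6 = ((117653 : ℕ) : ℚ) / (235298 : ℕ) := by norm_num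

/-- The prime divisors of `117653 · 117645 · 235298 = 2 · 3 · 5 · 7⁶ · 11 · 23 · 29 · 31 · 4057`. [folklore] -/
theorem eq_of_prime_dvd_triple_hex6 {p : ℕ} (hp : p.Prime) (h : p ∣ 117653 * 117645 * 235298) :
    p = 2 ∨ p = 3 ∨ p = 5 ∨ p = 7 ∨ p = 11 ∨ p = 23 ∨ p = 29 ∨ p = 31 ∨ p = 4057 := by
  have h' : p ∣ 2 * (3 * (5 * (7 ^ 6 * (11 * (23 * (29 * (31 * (4057)))))))) := by norm_num at h ⊢; exact h
  have key : ∀ {q k : ℕ}, q.Prime → p ∣ q ^ k → p = q := fun hq hd => (Nat.prime_dvd_prime_iff_eq hp hq).1 (hp.dvd_of_dvd_pow hd)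
  rcases (Nat.Prime.dvd_mul hp).1 h' with h1 | h1
  · exact (Or.inl ((Nat.prime_dvd_prime_iff_eq hp Nat.prime_two).1 h1))
  · rcases (Nat.Prime.dvd_mul hp).1 h1 with h2 | h2
    · exact (Or.inr (Or.inl ((Nat.prime_dvd_prime_iff_eq hp Nat.prime_three).1 h2)))
    · rcases (Nat.Prime.dvd_mul hp).1 h2 with h3 | h3
      · exact (Or.inr (Or.inr (Or.inl ((Nat.prime_dvd_prime_iff_eq hp Nat.prime_five).1 h3))))
      · rcases (Nat.Prime.dvd_mul hp).1 h3 with h4 | h4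
        · exact (Or.inr (Or.inr (Or.inr (Or.inl (key (by norm_num : Nat.Prime 7) h4)))))
        · rcases (Nat.Prime.dvd_mul hp).1 h4 with h5 | h5
          · exact (Or.inr (Or.inr (Or.inr (Or.inr (Or.inl ((Nat.prime_dvd_prime_iff_eq hp (by norm_num : Nat.Prime 11)).1 h5))))))
          · rcases (Nat.Prime.dvd_mul hp).1 h5 with h6 | h6
            · exact (Or.inr (Or.inr (Or.inr (Or.inr (Or.inr (Or.inl ((Nat.prime_dvd_prime_iff_eq hp (by norm_num : Nat.Prime 23)).1 h6)))))))
            · rcases (Nat.Prime.dvd_mul hp).1 h6 with h7 | h7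
              · exact (Or.inr (Or.inr (Or.inr (Or.inr (Or.inr (Or.inr (Or.inl ((Nat.prime_dvd_prime_iff_eq hp (by norm_num : Nat.Prime 29)).1 h7))))))))
              · rcases (Nat.Prime.dvd_mul hp).1 h7 with h8 | h8
                · exact (Or.inr (Or.inr (Or.inr (Or.inr (Or.inr (Or.inr (Or.inr (Or.inl ((Nat.prime_dvd_prime_iff_eq hp (by norm_num : Nat.Prime 31)).1 h8)))))))))
                · exact (Or.inr (Or.inr (Or.inr (Or.inr (Or.inr (Or.inr (Or.inr (Or.inr ((Nat.prime_dvd_prime_iff_eq hp (by norm_num : Nat.Prime 4057)).1 h8)))))))))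

/-- `v_3 = 1`, `v_5 = 1`, `v_7 = 6`, `v_11 = 1`, `v_23 = 1`, `v_29 = 1`, `v_31 = 1`, `v_4057 = 1` for `abc = 117653 · 117645 · 235298`. [folklore] -/
theorem factorization_triple_hex6 :
    (117653 * 117645 * 235298).factorization 3 = 1 ∧
      (117653 * 117645 * 235298).factorization 5 = 1 ∧
      (117653 * 117645 * 235298).factorization 7 = 6 ∧
      (117653 * 117645 * 235298).factorization 11 = 1 ∧
      (117653 * 117645 * 235298).factorization 23 = 1 ∧
      (117653 * 117645 * 235298).factorization 29 = 1 ∧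
      (117653 * 117645 * 235298).factorization 31 = 1 ∧
      (117653 * 117645 * 235298).factorization 4057 = 1 :=
  ⟨factorization_eq_of_eq_pow_mul_aux (m := 1085609064018710) Nat.prime_three (by norm_num) (by norm_num),
    factorization_eq_of_eq_pow_mul_aux (m := 651365438411226) Nat.prime_five (by norm_num) (by norm_num),
    factorization_eq_of_eq_pow_mul_aux (m := 27682574370) (by norm_num : Nat.Prime 7) (by norm_num) (by norm_num),
    factorization_eq_of_eq_pow_mul_aux (m := 296075199277830) (by norm_num : Nat.Prime 11) (by norm_num) (by norm_num),
    factorization_eq_of_eq_pow_mul_aux (m := 141601182263310) (by norm_num : Nat.Prime 23) (by norm_num) (by norm_num),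
    factorization_eq_of_eq_pow_mul_aux (m := 112304385932970) (by norm_num : Nat.Prime 29) (by norm_num) (by norm_num),
    factorization_eq_of_eq_pow_mul_aux (m := 105058941679230) (by norm_num : Nat.Prime 31) (by norm_num) (by norm_num),
    factorization_eq_of_eq_pow_mul_aux (m := 802767363090) (by norm_num : Nat.Prime 4057) (by norm_num) (by norm_num)⟩

/-- At the bad prime `31`: a prime level `l ≥ 11` does not divide `31 − 1 = 2·3·5` (so `l ∣ e` keeps `e` off the
cyclotomic indices `31^c·(31 − 1)`). [folklore] -/
theorem WRow.not_dvd_31_sub_one_hex6 {l : ℕ} (hl : l.Prime) (hl0 : 11 ≤ l) : ¬ l ∣ 31 - 1 := by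
  intro h
  have h' : l ∣ 2 * (3 * (5)) := by norm_num at h ⊢; exact h
  rcases (Nat.Prime.dvd_mul hl).1 h' with h1 | h1
  · have := (Nat.prime_dvd_prime_iff_eq hl Nat.prime_two).1 h1; omega
  rcases (Nat.Prime.dvd_mul hl).1 h1 with h2 | h2
  · have := (Nat.prime_dvd_prime_iff_eq hl Nat.prime_three).1 h2; omega
  · have := (Nat.prime_dvd_prime_iff_eq hl Nat.prime_five).1 h2; omega

/-- **The exact integer cells at `p = 7` for `k = 6` below the symbolic threshold `l ≥ 19`** (`l ∈ {11, 13, 17}`, `e = 5·l·n`, exponents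
`2`/`3`, slot `⌊e/6⌋`): at `n = 1` the floor is needed (floor-free margins are positive), so every label is checked by `decide`; every `n ≥ 2`
follows from the floor-free base cell at `n₀ = 2` (`WRow.cell_tameslot_of_ends`). Desk: HOME/staging/W/w5-d107/gen9/hexexact.py, hexsmall.py. [folklore] -/
theorem WRow.hexcell_six_small {l : ℕ} (hl : l = 11 ∨ l = 13 ∨ l = 17) {n : ℕ} (hn : 1 ≤ n) {i : ℕ} (hi : i < (l - 1) / 2) :
    ((5 * l * n : ℕ) : ℤ) * ((((i + 1 : ℕ) : ℤ) ^ 2 * ((5 * l * n * (2 * 6) / (2 * l) : ℕ) : ℤ) -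
            ((i + 1 : ℕ) : ℤ) * (((5 * l * n - 1 : ℕ) : ℕ) : ℤ) -
            ((i + 2 : ℕ) : ℤ) * ((((max 1 (5 * l * n / (7 - 1))) : ℕ) : ℤ))) / ((5 * l * n : ℕ) : ℤ)) +
          ((i + 2 : ℕ) : ℤ) * min (((7 : ℕ) : ℤ) ^ 2 - ((2 : ℕ) : ℤ) * ((5 * l * n : ℕ) : ℤ))
            (((7 : ℕ) : ℤ) ^ 3 - ((3 : ℕ) : ℤ) * ((5 * l * n : ℕ) : ℤ)) ≤
        ((5 * l * n * (2 * 6) / (2 * l) : ℕ) : ℤ) := by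
  rcases hl with rfl | rfl | rfl
  · rcases Nat.lt_or_ge n 2 with hn2 | hn2
    · obtain rfl : n = 1 := by omega
      norm_num at hi
      interval_cases i <;> decide +kernel
    · refine WRow.cell_tameslot_of_ends ((7 : ℕ) : ℤ) (5 * 11) (7 - 1) 9 (2 * 6) (2 * 11) 2 3 5 2 (by norm_num) (by norm_num) (by norm_num)
        (by norm_num) (by norm_num) (by norm_num) (by norm_num) ?_ hi hn2
      rintro i (rfl | hi')
      · norm_num
      · obtain rfl : i = 4 := by omega
        norm_num
  · rcases Nat.lt_or_ge n 2 with hn2 | hn2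
    · obtain rfl : n = 1 := by omega
      norm_num at hi
      interval_cases i <;> decide +kernel
    · refine WRow.cell_tameslot_of_ends ((7 : ℕ) : ℤ) (5 * 13) (7 - 1) 10 (2 * 6) (2 * 13) 2 3 6 2 (by norm_num) (by norm_num) (by norm_num)
        (by norm_num) (by norm_num) (by norm_num) (by norm_num) ?_ hi hn2
      rintro i (rfl | hi')
      · norm_num
      · obtain rfl : i = 5 := by omega
        norm_num
  · rcases Nat.lt_or_ge n 2 with hn2 | hn2
    · obtain rfl : n = 1 := by omega
      norm_num at hi
      interval_cases i <;> decide +kernel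
    · refine WRow.cell_tameslot_of_ends ((7 : ℕ) : ℤ) (5 * 17) (7 - 1) 14 (2 * 6) (2 * 17) 2 3 8 2 (by norm_num) (by norm_num) (by norm_num)
        (by norm_num) (by norm_num) (by norm_num) (by norm_num) ?_ hi hn2
      rintro i (rfl | hi')
      · norm_num
      · obtain rfl : i = 7 := by omega
        norm_num

/-! ## `k = 8`: `5764805 + 5764797 = 11529602` -/

/-- `(7⁸ + 4) + (7⁸ − 4) = 2·7⁸`, i.e. `5764805 + 5764797 = 11529602` (`5764805 = 5·41·61·461`, `5764797 = 3³·89·2399`): the abc triple whose Frey–Legendre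
point `a/c = 5764805/11529602` is the HEX parameter `λ_8 = 1/2 + 2/7⁸` of the R-W table (abc-iut-w5-d044 `Cor22.exists_admissible_prime_ratPoint_lamSeven`). [folklore] -/
theorem isABCTriple_hex8 : IsABCTriple 5764805 5764797 11529602 :=
  ⟨by norm_num, by norm_num, by norm_num, by norm_num [Nat.coprime_iff_gcd_eq_one]⟩

/-- `λ_8 = 1/2 + 2/7⁸ = 5764805/11529602`. [folklore] -/
theorem lamSeven_eq_hex8 : (2 : ℚ)⁻¹ + 2 / 7 ^ 8 = ((5764805 : ℕ) : ℚ) / (11529602 : ℕ) := by norm_num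

/-- The prime divisors of `5764805 · 5764797 · 11529602 = 2 · 3³ · 5 · 7⁸ · 41 · 61 · 89 · 461 · 2399`. [folklore] -/
theorem eq_of_prime_dvd_triple_hex8 {p : ℕ} (hp : p.Prime) (h : p ∣ 5764805 * 5764797 * 11529602) :
    p = 2 ∨ p = 3 ∨ p = 5 ∨ p = 7 ∨ p = 41 ∨ p = 61 ∨ p = 89 ∨ p = 461 ∨ p = 2399 := by
  have h' : p ∣ 2 * (3 ^ 3 * (5 * (7 ^ 8 * (41 * (61 * (89 * (461 * (2399)))))))) := by norm_num at h ⊢; exact h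
  have key : ∀ {q k : ℕ}, q.Prime → p ∣ q ^ k → p = q := fun hq hd => (Nat.prime_dvd_prime_iff_eq hp hq).1 (hp.dvd_of_dvd_pow hd)
  rcases (Nat.Prime.dvd_mul hp).1 h' with h1 | h1
  · exact (Or.inl ((Nat.prime_dvd_prime_iff_eq hp Nat.prime_two).1 h1))
  · rcases (Nat.Prime.dvd_mul hp).1 h1 with h2 | h2
    · exact (Or.inr (Or.inl (key Nat.prime_three h2)))
    · rcases (Nat.Prime.dvd_mul hp).1 h2 with h3 | h3
      · exact (Or.inr (Or.inr (Or.inl ((Nat.prime_dvd_prime_iff_eq hp Nat.prime_five).1 h3))))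
      · rcases (Nat.Prime.dvd_mul hp).1 h3 with h4 | h4
        · exact (Or.inr (Or.inr (Or.inr (Or.inl (key (by norm_num : Nat.Prime 7) h4)))))
        · rcases (Nat.Prime.dvd_mul hp).1 h4 with h5 | h5
          · exact (Or.inr (Or.inr (Or.inr (Or.inr (Or.inl ((Nat.prime_dvd_prime_iff_eq hp (by norm_num : Nat.Prime 41)).1 h5))))))
          · rcases (Nat.Prime.dvd_mul hp).1 h5 with h6 | h6
            · exact (Or.inr (Or.inr (Or.inr (Or.inr (Or.inr (Or.inl ((Nat.prime_dvd_prime_iff_eq hp (by norm_num : Nat.Prime 61)).1 h6)))))))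
            · rcases (Nat.Prime.dvd_mul hp).1 h6 with h7 | h7
              · exact (Or.inr (Or.inr (Or.inr (Or.inr (Or.inr (Or.inr (Or.inl ((Nat.prime_dvd_prime_iff_eq hp (by norm_num : Nat.Prime 89)).1 h7))))))))
              · rcases (Nat.Prime.dvd_mul hp).1 h7 with h8 | h8
                · exact (Or.inr (Or.inr (Or.inr (Or.inr (Or.inr (Or.inr (Or.inr (Or.inl ((Nat.prime_dvd_prime_iff_eq hp (by norm_num : Nat.Prime 461)).1 h8)))))))))
                · exact (Or.inr (Or.inr (Or.inr (Or.inr (Or.inr (Or.inr (Or.inr (Or.inr ((Nat.prime_dvd_prime_iff_eq hp (by norm_num : Nat.Prime 2399)).1 h8)))))))))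

/-- `v_3 = 3`, `v_5 = 1`, `v_7 = 8`, `v_41 = 1`, `v_61 = 1`, `v_89 = 1`, `v_461 = 1`, `v_2399 = 1` for `abc = 5764805 · 5764797 · 11529602`. [folklore] -/
theorem factorization_triple_hex8 :
    (5764805 * 5764797 * 11529602).factorization 3 = 3 ∧
      (5764805 * 5764797 * 11529602).factorization 5 = 1 ∧
      (5764805 * 5764797 * 11529602).factorization 7 = 8 ∧
      (5764805 * 5764797 * 11529602).factorization 41 = 1 ∧
      (5764805 * 5764797 * 11529602).factorization 61 = 1 ∧
      (5764805 * 5764797 * 11529602).factorization 89 = 1 ∧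
      (5764805 * 5764797 * 11529602).factorization 461 = 1 ∧
      (5764805 * 5764797 * 11529602).factorization 2399 = 1 :=
  ⟨factorization_eq_of_eq_pow_mul_aux (m := 14191202324479568710) Nat.prime_three (by norm_num) (by norm_num),
    factorization_eq_of_eq_pow_mul_aux (m := 76632492552189671034) Nat.prime_five (by norm_num) (by norm_num),
    factorization_eq_of_eq_pow_mul_aux (m := 66465861139170) (by norm_num : Nat.Prime 7) (by norm_num) (by norm_num),
    factorization_eq_of_eq_pow_mul_aux (m := 9345425920998740370) (by norm_num : Nat.Prime 41) (by norm_num) (by norm_num),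
    factorization_eq_of_eq_pow_mul_aux (m := 6281351848540136970) (by norm_num : Nat.Prime 61) (by norm_num) (by norm_num),
    factorization_eq_of_eq_pow_mul_aux (m := 4305196210797172530) (by norm_num : Nat.Prime 89) (by norm_num) (by norm_num),
    factorization_eq_of_eq_pow_mul_aux (m := 831155016835028970) (by norm_num : Nat.Prime 461) (by norm_num) (by norm_num),
    factorization_eq_of_eq_pow_mul_aux (m := 159717575140036830) (by norm_num : Nat.Prime 2399) (by norm_num) (by norm_num)⟩

/-- **The exact integer cells at `p = 7` for `k = 8` below the symbolic threshold `l ≥ 79`** (`l ∈ {73}`, `e = 15·l·n`, exponents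
`3`/`4`, slot `⌊e/6⌋`): at `n = 1` the floor is needed (floor-free margins are positive), so every label is checked by `decide`; every `n ≥ 2`
follows from the floor-free base cell at `n₀ = 2` (`WRow.cell_tameslot_of_ends`). Desk: HOME/staging/W/w5-d107/gen9/hexexact.py, hexsmall.py. [folklore] -/
theorem WRow.hexcell_eight_small {l : ℕ} (hl : l = 73) {n : ℕ} (hn : 1 ≤ n) {i : ℕ} (hi : i < (l - 1) / 2) :
    ((15 * l * n : ℕ) : ℤ) * ((((i + 1 : ℕ) : ℤ) ^ 2 * ((15 * l * n * (2 * 8) / (2 * l) : ℕ) : ℤ) -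
            ((i + 1 : ℕ) : ℤ) * (((15 * l * n - 1 : ℕ) : ℕ) : ℤ) -
            ((i + 2 : ℕ) : ℤ) * ((((max 1 (15 * l * n / (7 - 1))) : ℕ) : ℤ))) / ((15 * l * n : ℕ) : ℤ)) +
          ((i + 2 : ℕ) : ℤ) * min (((7 : ℕ) : ℤ) ^ 3 - ((3 : ℕ) : ℤ) * ((15 * l * n : ℕ) : ℤ))
            (((7 : ℕ) : ℤ) ^ 4 - ((4 : ℕ) : ℤ) * ((15 * l * n : ℕ) : ℤ)) ≤
        ((15 * l * n * (2 * 8) / (2 * l) : ℕ) : ℤ) := by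
  subst hl
  rcases Nat.lt_or_ge n 2 with hn2 | hn2
  · obtain rfl : n = 1 := by omega
    norm_num at hi
    interval_cases i <;> decide +kernel
  · refine WRow.cell_tameslot_of_ends ((7 : ℕ) : ℤ) (15 * 73) (7 - 1) 182 (2 * 8) (2 * 73) 3 4 36 2 (by norm_num) (by norm_num) (by norm_num)
      (by norm_num) (by norm_num) (by norm_num) (by norm_num) ?_ hi hn2
    rintro i (rfl | hi')
    · norm_num
    · obtain rfl : i = 35 := by omega
      norm_num

end Summit.ABC.IUTFork.Conditional

end
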